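import Summits.Ventures.CertifiedManyBodySolver.Downfold.EmeryShapeWindowClosureBand
import Summits.Ventures.CertifiedManyBodySolver.Downfold.EmeryFermiScaleLever
import Summits.Ventures.CertifiedManyBodySolver.Downfold.EmeryOrbitalWeightFaceBox
import Summits.Ventures.CertifiedManyBodySolver.Downfold.EmeryFermiSurfaceHoleLike
import HarnessLib

/-!
# THE ONE-BAND IMAGE OVER A FILLING BAND: at fixed σ row every image coordinate is monotone in the Fermi energy, and the Fermi energy is monotone in the filling —
# so windows certified at the two END fillings of a doping band hold at EVERY filling in between (INFL-3to1-B §B.98; the band form of §B.88–§B.97)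

Venture CertifiedManyBodySolver, cell `pub/hubbard-downfold` (stage S1; INFLATION-RULES-3to1-B §B.98), seat hubbard-downfold-mod-4 (technique B = band level, g43);
namespace `Summit.Ventures.CertifiedManyBodySolver.Downfold.Emery`. Everything PROVED (0 sorry, no definition, no certificate — pure composition of landed levers).
WHAT THIS IS NOT: a statement about any material; `U = 0` one-body kinematics of the σ (d–p_x–p_y + t_pp, t_pp′) model (rigid band); no number lives here.

THE DEVICE. For a σ row `θ = (Δ, a, b, c) = (Δ_pd, t_pd, t_pp, t_pp′)` and fillings `0 < ν₁ ≤ ν ≤ ν₂ < 1` the Fermi energy is non-decreasing in the filling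
(`fermiEnergyOf_mono_filling'`), and at FIXED `θ` the corpus already proves that every coordinate of the one-band image is monotone in the energy:
* the velocity-matched nodal hopping `t_node(θ; ε) = scaleT θ (xNode θ ε) (xNode θ ε) ε` is strictly DECREASING (`scaleT_node_strictAnti`, regime `t_pp′ε < t_pd²`, `t_ppΔ < 4t_pd²`);
* the nodal Cu-d weight `dWeightNode θ ε` is DECREASING (`dWeightNode_antitone`);
* the zone-face (antinodal) Cu-d weight `dWeightFace θ ε` is DECREASING between a hole-like energy and an energy whose contour stays inside the zone (`dWeightFace_antitone`);
  the upper face edge is transported DOWN in energy by `faceHi_anti`, so ONE inequality `0 ≤ faceU θ E_h` at a ceiling `E_h ≥ ε_F(θ; ν₂)` serves the whole band, and over a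
  typed box it follows from FOUR corner inequalities at the box's lowest `t_pd` (`faceU_mono_tpd`, `faceU_nonneg_on_box4`);
* the Γ–X axis Cu-d weight `dWeightAxis θ ε` is DECREASING (`dWeightAxisCF_anti_eps`);
* hole-likeness `1 − 2ν < x_VH(θ)` is monotone in `ν`, electron-likeness `x_VH(θ) < 1 − 2ν` antitone.
Hence for `ν ∈ [ν₁, ν₂]` each coordinate of `θ` lies between its values at `ν₂` and at `ν₁` (`…_fermiEnergyOf_band`), and any windows certified for every member of a box at the
two end fillings (the landed column theorems) hold for every member at EVERY filling of the band (`mem_Icc_of_band_ends`). The Fermi-surface shape `t′/t` is not monotone in the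
energy uniformly over a box; its band form is the true-corner band device `EmeryShapeTrueCornerBand` (§B.87 (j)). The universal axis-corner ceiling over a box transports the
same way (`dWeight_le_of_mem_box_axis'_band`).

Sources: three-band model [HybertsenSchluterChristensen1989, Eq. (1)]; energy-linearised one-band image / contour form [AndersenEtAl1995, §6]; arithmetic [folklore].
-/

noncomputable section

namespace Summit.Ventures.CertifiedManyBodySolver.Downfold.Emery

open Real Set

/-! ## §0 Book-keeping -/

/-- A value squeezed between its two end-of-band values inherits the end windows: `v₂ ≤ v ≤ v₁`, `L ≤ v₂`, `v₁ ≤ U` ⇒ `v ∈ [L, U]`. [folklore] -/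
theorem mem_Icc_of_band_ends {v v₁ v₂ L U : ℝ} (h : v₂ ≤ v ∧ v ≤ v₁) (hL : L ≤ v₂) (hU : v₁ ≤ U) : v ∈ Icc L U :=
  ⟨hL.trans h.1, h.2.trans hU⟩

/-- The Fermi energy over a filling band is below any ceiling of its value at the top filling: `ν ≤ ν₂ < 1`, `ε_F(ν₂) ≤ E_h` ⇒ `ε_F(ν) ≤ E_h`. [folklore] -/
theorem fermiEnergyOf_le_of_band {Δ a b c ν ν₂ Eh : ℝ} (hΔ : 0 < Δ) (ha : a ≠ 0) (hc : 0 ≤ c) (hb : 0 ≤ b) (hν0 : 0 < ν) (hν : ν ≤ ν₂) (hν₂1 : ν₂ < 1)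
    (hEh : fermiEnergyOf Δ a b c ν₂ ≤ Eh) : fermiEnergyOf Δ a b c ν ≤ Eh :=
  (fermiEnergyOf_mono_filling' hΔ ha hc hb hν0 hν hν₂1).trans hEh

/-- … and above any floor of its value at the bottom filling: `0 < ν₁ ≤ ν < 1`, `E_l ≤ ε_F(ν₁)` ⇒ `E_l ≤ ε_F(ν)`. [folklore] -/
theorem le_fermiEnergyOf_of_band {Δ a b c ν ν₁ El : ℝ} (hΔ : 0 < Δ) (ha : a ≠ 0) (hc : 0 ≤ c) (hb : 0 ≤ b) (hν₁0 : 0 < ν₁) (hν : ν₁ ≤ ν) (hν1 : ν < 1)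
    (hEl : El ≤ fermiEnergyOf Δ a b c ν₁) : El ≤ fermiEnergyOf Δ a b c ν :=
  hEl.trans (fermiEnergyOf_mono_filling' hΔ ha hc hb hν₁0 hν hν1)

/-! ## §1 The nodal one-band hopping `t` over a filling band -/

/-- **FILLING LEVER FOR THE NODAL SCALE**: `ν ≤ ν′` ⇒ `t_node(θ; ε_F(ν′)) ≤ t_node(θ; ε_F(ν))` — hole doping (lower filling) RAISES the velocity-matched one-band `t`
(`Δ > 0`, `t_pd ≠ 0`, `0 ≤ t_pp′ ≤ t_pp`, `0 < ν ≤ ν′ < 1`, regime `t_pp′·ε_F(ν′) < t_pd²`, `t_pp·Δ < 4t_pd²`). [folklore] -/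
theorem scaleT_node_fermiEnergyOf_anti_filling {Δ a b c ν ν' : ℝ} (hΔ : 0 < Δ) (ha : a ≠ 0) (hc : 0 ≤ c) (hcb : c ≤ b) (hν0 : 0 < ν) (hνν : ν ≤ ν')
    (hν1 : ν' < 1) (hm : c * fermiEnergyOf Δ a b c ν' < a ^ 2) (hq : b * Δ < 4 * a ^ 2) :
    scaleT Δ a b c (xNode Δ a b c (fermiEnergyOf Δ a b c ν')) (xNode Δ a b c (fermiEnergyOf Δ a b c ν')) (fermiEnergyOf Δ a b c ν') ≤
      scaleT Δ a b c (xNode Δ a b c (fermiEnergyOf Δ a b c ν)) (xNode Δ a b c (fermiEnergyOf Δ a b c ν)) (fermiEnergyOf Δ a b c ν) := by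
  have hb : 0 ≤ b := hc.trans hcb
  have hE : 0 < fermiEnergyOf Δ a b c ν := fermiEnergyOf_pos hΔ ha hc hb hν0 (lt_of_le_of_lt hνν hν1)
  rcases (fermiEnergyOf_mono_filling' hΔ ha hc hb hν0 hνν hν1).lt_or_eq with hlt | heq
  · exact (scaleT_node_strictAnti hΔ hc hcb ha hE hlt hm hq).le
  · rw [heq]

/-- **THE NODAL SCALE OVER A FILLING BAND**: for `ν ∈ [ν₁, ν₂]`, `t_node(θ; ε_F(ν₂)) ≤ t_node(θ; ε_F(ν)) ≤ t_node(θ; ε_F(ν₁))`. [folklore] -/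
theorem scaleT_node_fermiEnergyOf_band {Δ a b c ν ν₁ ν₂ : ℝ} (hΔ : 0 < Δ) (ha : a ≠ 0) (hc : 0 ≤ c) (hcb : c ≤ b) (hν₁0 : 0 < ν₁) (hν : ν ∈ Icc ν₁ ν₂)
    (hν₂1 : ν₂ < 1) (hm : c * fermiEnergyOf Δ a b c ν₂ < a ^ 2) (hq : b * Δ < 4 * a ^ 2) :
    scaleT Δ a b c (xNode Δ a b c (fermiEnergyOf Δ a b c ν₂)) (xNode Δ a b c (fermiEnergyOf Δ a b c ν₂)) (fermiEnergyOf Δ a b c ν₂) ≤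
        scaleT Δ a b c (xNode Δ a b c (fermiEnergyOf Δ a b c ν)) (xNode Δ a b c (fermiEnergyOf Δ a b c ν)) (fermiEnergyOf Δ a b c ν) ∧
      scaleT Δ a b c (xNode Δ a b c (fermiEnergyOf Δ a b c ν)) (xNode Δ a b c (fermiEnergyOf Δ a b c ν)) (fermiEnergyOf Δ a b c ν) ≤
        scaleT Δ a b c (xNode Δ a b c (fermiEnergyOf Δ a b c ν₁)) (xNode Δ a b c (fermiEnergyOf Δ a b c ν₁)) (fermiEnergyOf Δ a b c ν₁) := by
  have hν0 : 0 < ν := lt_of_lt_of_le hν₁0 hν.1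
  have hν1 : ν < 1 := lt_of_le_of_lt hν.2 hν₂1
  have hb : 0 ≤ b := hc.trans hcb
  have hmν : c * fermiEnergyOf Δ a b c ν < a ^ 2 :=
    lt_of_le_of_lt (mul_le_mul_of_nonneg_left (fermiEnergyOf_mono_filling' hΔ ha hc hb hν0 hν.2 hν₂1) hc) hm
  exact ⟨scaleT_node_fermiEnergyOf_anti_filling hΔ ha hc hcb hν0 hν.2 hν₂1 hm hq,
    scaleT_node_fermiEnergyOf_anti_filling hΔ ha hc hcb hν₁0 hν.1 hν1 hmν hq⟩

/-- **Band read-out for `t`**: windows `L ≤ t_node(θ; ν₂)` and `t_node(θ; ν₁) ≤ U` at the END fillings give `t_node(θ; ν) ∈ [L, U]` at every `ν ∈ [ν₁, ν₂]`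
(regime margin taken at a ceiling `E_h ≥ ε_F(θ; ν₂)`). [folklore] -/
theorem scaleT_node_fermiEnergyOf_mem_Icc_of_band {Δ a b c ν ν₁ ν₂ Eh L U : ℝ} (hΔ : 0 < Δ) (ha : a ≠ 0) (hc : 0 ≤ c) (hcb : c ≤ b) (hν₁0 : 0 < ν₁)
    (hν : ν ∈ Icc ν₁ ν₂) (hν₂1 : ν₂ < 1) (hEh : fermiEnergyOf Δ a b c ν₂ ≤ Eh) (hm : c * Eh < a ^ 2) (hq : b * Δ < 4 * a ^ 2)
    (hL : L ≤ scaleT Δ a b c (xNode Δ a b c (fermiEnergyOf Δ a b c ν₂)) (xNode Δ a b c (fermiEnergyOf Δ a b c ν₂)) (fermiEnergyOf Δ a b c ν₂))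
    (hU : scaleT Δ a b c (xNode Δ a b c (fermiEnergyOf Δ a b c ν₁)) (xNode Δ a b c (fermiEnergyOf Δ a b c ν₁)) (fermiEnergyOf Δ a b c ν₁) ≤ U) :
    scaleT Δ a b c (xNode Δ a b c (fermiEnergyOf Δ a b c ν)) (xNode Δ a b c (fermiEnergyOf Δ a b c ν)) (fermiEnergyOf Δ a b c ν) ∈ Icc L U :=
  mem_Icc_of_band_ends (scaleT_node_fermiEnergyOf_band hΔ ha hc hcb hν₁0 hν hν₂1 (lt_of_le_of_lt (mul_le_mul_of_nonneg_left hEh hc) hm) hq) hL hU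

/-! ## §2 The nodal Cu-d weight over a filling band -/

/-- **FILLING LEVER FOR THE NODAL WEIGHT**: `ν ≤ ν′` ⇒ `w_node(θ; ε_F(ν′)) ≤ w_node(θ; ε_F(ν))` (`Δ > 0`, `t_pd ≠ 0`, `0 ≤ t_pp′ ≤ t_pp`, `0 < ν ≤ ν′ < 1`). [folklore] -/
theorem dWeightNode_fermiEnergyOf_anti_filling {Δ a b c ν ν' : ℝ} (hΔ : 0 < Δ) (ha : a ≠ 0) (hc : 0 ≤ c) (hcb : c ≤ b) (hν0 : 0 < ν) (hνν : ν ≤ ν')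
    (hν1 : ν' < 1) : dWeightNode Δ a b c (fermiEnergyOf Δ a b c ν') ≤ dWeightNode Δ a b c (fermiEnergyOf Δ a b c ν) := by
  have hb : 0 ≤ b := hc.trans hcb
  exact dWeightNode_antitone hΔ hc hcb ha (fermiEnergyOf_pos hΔ ha hc hb hν0 (lt_of_le_of_lt hνν hν1))
    (fermiEnergyOf_mono_filling' hΔ ha hc hb hν0 hνν hν1)

/-- **THE NODAL WEIGHT OVER A FILLING BAND**: for `ν ∈ [ν₁, ν₂]`, `w_node(θ; ν₂) ≤ w_node(θ; ν) ≤ w_node(θ; ν₁)`. [folklore] -/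
theorem dWeightNode_fermiEnergyOf_band {Δ a b c ν ν₁ ν₂ : ℝ} (hΔ : 0 < Δ) (ha : a ≠ 0) (hc : 0 ≤ c) (hcb : c ≤ b) (hν₁0 : 0 < ν₁) (hν : ν ∈ Icc ν₁ ν₂)
    (hν₂1 : ν₂ < 1) :
    dWeightNode Δ a b c (fermiEnergyOf Δ a b c ν₂) ≤ dWeightNode Δ a b c (fermiEnergyOf Δ a b c ν) ∧
      dWeightNode Δ a b c (fermiEnergyOf Δ a b c ν) ≤ dWeightNode Δ a b c (fermiEnergyOf Δ a b c ν₁) :=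
  ⟨dWeightNode_fermiEnergyOf_anti_filling hΔ ha hc hcb (lt_of_lt_of_le hν₁0 hν.1) hν.2 hν₂1,
    dWeightNode_fermiEnergyOf_anti_filling hΔ ha hc hcb hν₁0 hν.1 (lt_of_le_of_lt hν.2 hν₂1)⟩

/-- **Band read-out for `w_node`**: `L ≤ w_node(θ; ν₂)`, `w_node(θ; ν₁) ≤ U` ⇒ `w_node(θ; ν) ∈ [L, U]` at every `ν ∈ [ν₁, ν₂]`. [folklore] -/
theorem dWeightNode_fermiEnergyOf_mem_Icc_of_band {Δ a b c ν ν₁ ν₂ L U : ℝ} (hΔ : 0 < Δ) (ha : a ≠ 0) (hc : 0 ≤ c) (hcb : c ≤ b) (hν₁0 : 0 < ν₁)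
    (hν : ν ∈ Icc ν₁ ν₂) (hν₂1 : ν₂ < 1) (hL : L ≤ dWeightNode Δ a b c (fermiEnergyOf Δ a b c ν₂))
    (hU : dWeightNode Δ a b c (fermiEnergyOf Δ a b c ν₁) ≤ U) : dWeightNode Δ a b c (fermiEnergyOf Δ a b c ν) ∈ Icc L U :=
  mem_Icc_of_band_ends (dWeightNode_fermiEnergyOf_band hΔ ha hc hcb hν₁0 hν hν₂1) hL hU

/-! ## §3 The zone-face (antinodal) Cu-d weight over a filling band -/

/-- `faceU` is non-decreasing in `t_pd` (`0 ≤ a ≤ a′`, `Δ + ε ≥ 0`, `t_pp + t_pp′ ≥ 0`): its `a²`-coefficient is `8(Δ + ε) + 32(t_pp + t_pp′) ≥ 0`. [folklore] -/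
theorem faceU_mono_tpd {Δ a a' b c ε : ℝ} (hE : 0 ≤ Δ + ε) (hbc : 0 ≤ b + c) (ha : 0 ≤ a) (haa : a ≤ a') :
    faceU Δ a b c ε ≤ faceU Δ a' b c ε := by
  have key : faceU Δ a' b c ε - faceU Δ a b c ε = (a' ^ 2 - a ^ 2) * (8 * (Δ + ε) + 32 * (c + b)) := by
    rw [faceU_eq, faceU_eq]; ring
  have hsq : 0 ≤ a' ^ 2 - a ^ 2 := by nlinarith
  have h : 0 ≤ (a' ^ 2 - a ^ 2) * (8 * (Δ + ε) + 32 * (c + b)) := mul_nonneg hsq (by linarith)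
  linarith

/-- **THE UPPER FACE EDGE OVER A FOUR-COORDINATE BOX FROM FOUR CORNERS**: `0 ≤ faceU` at the corners `(Δᵢ, a₁, b₁, cⱼ)` (lowest `t_pd`, lowest `t_pp`) at energy `ε ≥ 0`
⇒ `0 ≤ faceU(Δ, a, b, c; ε)` for every `Δ ∈ [Δ₁, Δ₂]`, `a ≥ a₁ ≥ 0`, `b ≥ b₁ ≥ 0`, `c ∈ [c₁, c₂]` (`Δ₁, c₁ ≥ 0`; `faceU_nonneg_on_box` + `faceU_mono_tpd`). [folklore] -/
theorem faceU_nonneg_on_box4 {Δ a b c Δ₁ Δ₂ a₁ b₁ c₁ c₂ ε : ℝ} (hε : 0 ≤ ε) (hΔ₁ : 0 ≤ Δ₁) (ha₁ : 0 ≤ a₁) (hb₁ : 0 ≤ b₁) (hc₁ : 0 ≤ c₁)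
    (hΔ : Δ ∈ Icc Δ₁ Δ₂) (ha : a₁ ≤ a) (hb : b₁ ≤ b) (hc : c ∈ Icc c₁ c₂)
    (h11 : 0 ≤ faceU Δ₁ a₁ b₁ c₁ ε) (h12 : 0 ≤ faceU Δ₁ a₁ b₁ c₂ ε) (h21 : 0 ≤ faceU Δ₂ a₁ b₁ c₁ ε) (h22 : 0 ≤ faceU Δ₂ a₁ b₁ c₂ ε) :
    0 ≤ faceU Δ a b c ε :=
  (faceU_nonneg_on_box hε hb₁ hΔ hb hc h11 h12 h21 h22).trans
    (faceU_mono_tpd (by linarith [hΔ.1]) (by linarith [hc.1]) ha₁ ha)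

/-- **Energy lever for the antinodal weight with the face edge read at a ceiling**: `0 < ε₁ ≤ ε₂ ≤ E_h`, `t_pp′E_h < t_pd²`, the `ε₁`-surface hole-like
(`0 ≤ faceG(ε₁)`) and `0 ≤ faceU(θ; E_h)` ⇒ `dWeightFace(θ; ε₂) ≤ dWeightFace(θ; ε₁)` (`dWeightFace_antitone` + `faceHi_anti`). [folklore] -/
theorem dWeightFace_anti_eps_of_faceU {Δ a b c ε₁ ε₂ Eh : ℝ} (hΔ : 0 < Δ) (ha : a ≠ 0) (hc : 0 ≤ c) (hcb : c ≤ b) (h1 : 0 < ε₁) (h12 : ε₁ ≤ ε₂)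
    (h2h : ε₂ ≤ Eh) (hm : c * Eh < a ^ 2) (hG : 0 ≤ faceG Δ a c ε₁) (hU : 0 ≤ faceU Δ a b c Eh) :
    dWeightFace Δ a b c ε₂ ≤ dWeightFace Δ a b c ε₁ := by
  have h2 : 0 < ε₂ := lt_of_lt_of_le h1 h12
  have hm2 : c * ε₂ < a ^ 2 := lt_of_le_of_lt (mul_le_mul_of_nonneg_left h2h hc) hm
  have hhi := faceHi_anti hΔ.le hc (by linarith [hc.trans hcb]) h2 h2h ((faceU_nonneg_iff _ _ _ _ _).1 hU)
  exact dWeightFace_antitone hΔ hc hcb ha h1 h12 hm2 hG hhi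

/-- **FILLING LEVER FOR THE ANTINODAL WEIGHT**: `ν ≤ ν′`, the row hole-like at `ν` (`1 − 2ν ≤ x_VH(θ)`), `ε_F(ν′) ≤ E_h`, `t_pp′E_h < t_pd²`, `0 ≤ faceU(θ; E_h)`
⇒ `w_face(θ; ε_F(ν′)) ≤ w_face(θ; ε_F(ν))`. [folklore] -/
theorem dWeightFace_fermiEnergyOf_anti_filling {Δ a b c ν ν' Eh : ℝ} (hΔ : 0 < Δ) (ha : 0 < a) (hc : 0 ≤ c) (hcb : c ≤ b) (hν0 : 0 < ν) (hνν : ν ≤ ν')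
    (hν1 : ν' < 1) (hx : 1 - 2 * ν ≤ xVH Δ a b c) (hEh : fermiEnergyOf Δ a b c ν' ≤ Eh) (hm : c * Eh < a ^ 2) (hU : 0 ≤ faceU Δ a b c Eh) :
    dWeightFace Δ a b c (fermiEnergyOf Δ a b c ν') ≤ dWeightFace Δ a b c (fermiEnergyOf Δ a b c ν) := by
  have hb : 0 ≤ b := hc.trans hcb
  have hν1' : ν < 1 := lt_of_le_of_lt hνν hν1
  exact dWeightFace_anti_eps_of_faceU hΔ ha.ne' hc hcb (fermiEnergyOf_pos hΔ ha.ne' hc hb hν0 hν1')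
    (fermiEnergyOf_mono_filling' hΔ ha.ne' hc hb hν0 hνν hν1) hEh hm (faceG_fermiEnergyOf_nonneg_of_xVH hΔ ha.ne' hc hb hν0 hν1' hx) hU

/-- **THE ANTINODAL WEIGHT OVER A FILLING BAND**: `ν ∈ [ν₁, ν₂]`, the row hole-like at the band's most-doped end (`1 − 2ν₁ ≤ X ≤ x_VH(θ)`), `ε_F(θ; ν₂) ≤ E_h`,
`t_pp′E_h < t_pd²`, `0 ≤ faceU(θ; E_h)` ⇒ `w_face(θ; ν₂) ≤ w_face(θ; ν) ≤ w_face(θ; ν₁)`. [folklore] -/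
theorem dWeightFace_fermiEnergyOf_band {Δ a b c ν ν₁ ν₂ X Eh : ℝ} (hΔ : 0 < Δ) (ha : 0 < a) (hc : 0 ≤ c) (hcb : c ≤ b) (hν₁0 : 0 < ν₁)
    (hν : ν ∈ Icc ν₁ ν₂) (hν₂1 : ν₂ < 1) (hxX : X ≤ xVH Δ a b c) (hX : 1 - 2 * ν₁ ≤ X) (hEh : fermiEnergyOf Δ a b c ν₂ ≤ Eh) (hm : c * Eh < a ^ 2)
    (hU : 0 ≤ faceU Δ a b c Eh) :
    dWeightFace Δ a b c (fermiEnergyOf Δ a b c ν₂) ≤ dWeightFace Δ a b c (fermiEnergyOf Δ a b c ν) ∧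
      dWeightFace Δ a b c (fermiEnergyOf Δ a b c ν) ≤ dWeightFace Δ a b c (fermiEnergyOf Δ a b c ν₁) := by
  have hb : 0 ≤ b := hc.trans hcb
  have hν0 : 0 < ν := lt_of_lt_of_le hν₁0 hν.1
  have hν1 : ν < 1 := lt_of_le_of_lt hν.2 hν₂1
  have hx₁ : 1 - 2 * ν₁ ≤ xVH Δ a b c := hX.trans hxX
  have hx : 1 - 2 * ν ≤ xVH Δ a b c := le_trans (by linarith [hν.1]) hx₁
  exact ⟨dWeightFace_fermiEnergyOf_anti_filling hΔ ha hc hcb hν0 hν.2 hν₂1 hx hEh hm hU,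
    dWeightFace_fermiEnergyOf_anti_filling hΔ ha hc hcb hν₁0 hν.1 hν1 hx₁
      (fermiEnergyOf_le_of_band hΔ ha.ne' hc hb hν0 hν.2 hν₂1 hEh) hm hU⟩

/-- **Band read-out for `w_face`**: `L ≤ w_face(θ; ν₂)`, `w_face(θ; ν₁) ≤ U` ⇒ `w_face(θ; ν) ∈ [L, U]` at every `ν ∈ [ν₁, ν₂]` (hypotheses of
`dWeightFace_fermiEnergyOf_band`). [folklore] -/
theorem dWeightFace_fermiEnergyOf_mem_Icc_of_band {Δ a b c ν ν₁ ν₂ X Eh L U : ℝ} (hΔ : 0 < Δ) (ha : 0 < a) (hc : 0 ≤ c) (hcb : c ≤ b) (hν₁0 : 0 < ν₁)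
    (hν : ν ∈ Icc ν₁ ν₂) (hν₂1 : ν₂ < 1) (hxX : X ≤ xVH Δ a b c) (hX : 1 - 2 * ν₁ ≤ X) (hEh : fermiEnergyOf Δ a b c ν₂ ≤ Eh) (hm : c * Eh < a ^ 2)
    (hU : 0 ≤ faceU Δ a b c Eh) (hL : L ≤ dWeightFace Δ a b c (fermiEnergyOf Δ a b c ν₂)) (hU' : dWeightFace Δ a b c (fermiEnergyOf Δ a b c ν₁) ≤ U) :
    dWeightFace Δ a b c (fermiEnergyOf Δ a b c ν) ∈ Icc L U :=
  mem_Icc_of_band_ends (dWeightFace_fermiEnergyOf_band hΔ ha hc hcb hν₁0 hν hν₂1 hxX hX hEh hm hU) hL hU'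

/-! ## §4 The Γ–X axis Cu-d weight over a filling band -/

/-- **Energy lever for the axis weight** (`EmeryOrbitalWeightAxisBox.dWeightAxisCF_anti_eps` on `dWeightAxis` itself): `0 < ε₁ ≤ ε₂`, `t_pp′ε₂ < t_pd²`,
`t_pp′(Δ(ε₁ + ε₂) + ε₁ε₂) ≤ t_pd²Δ` ⇒ `dWeightAxis(θ; ε₂) ≤ dWeightAxis(θ; ε₁)`. [folklore] -/
theorem dWeightAxis_anti_eps {Δ a b c ε₁ ε₂ : ℝ} (hΔ : 0 < Δ) (ha : a ≠ 0) (hc : 0 ≤ c) (h1 : 0 < ε₁) (h12 : ε₁ ≤ ε₂) (hm : c * ε₂ < a ^ 2)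
    (hlev : c * (Δ * (ε₁ + ε₂) + ε₁ * ε₂) ≤ a ^ 2 * Δ) : dWeightAxis Δ a b c ε₂ ≤ dWeightAxis Δ a b c ε₁ := by
  have h2 : 0 < ε₂ := lt_of_lt_of_le h1 h12
  have hm1 : c * ε₁ < a ^ 2 := lt_of_le_of_lt (mul_le_mul_of_nonneg_left h12 hc) hm
  rw [dWeightAxis_eq_CF (by linarith) h2 ha hm, dWeightAxis_eq_CF (by linarith) h1 ha hm1]
  exact dWeightAxisCF_anti_eps hΔ hc h1.le h12 hm hlev

/-- The axis-lever margin at two energies below a ceiling follows from the margin at the ceiling: `0 ≤ ε₁ ≤ ε₂ ≤ E_h`, `Δ ≥ 0`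
⇒ `Δ(ε₁ + ε₂) + ε₁ε₂ ≤ 2ΔE_h + E_h²`. [folklore] -/
theorem axisLever_le_of_ceiling {Δ ε₁ ε₂ Eh : ℝ} (hΔ : 0 ≤ Δ) (h1 : 0 ≤ ε₁) (h12 : ε₁ ≤ ε₂) (h2h : ε₂ ≤ Eh) :
    Δ * (ε₁ + ε₂) + ε₁ * ε₂ ≤ 2 * Δ * Eh + Eh ^ 2 := by
  have h2 : 0 ≤ ε₂ := h1.trans h12
  have hp : ε₁ * ε₂ ≤ Eh * Eh := mul_le_mul (h12.trans h2h) h2h h2 (h2.trans h2h)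
  nlinarith

/-- **THE AXIS WEIGHT OVER A FILLING BAND**: `ν ∈ [ν₁, ν₂]`, `ε_F(θ; ν₂) ≤ E_h`, `t_pp′E_h < t_pd²`, `t_pp′(2ΔE_h + E_h²) ≤ t_pd²Δ`
⇒ `w_axis(θ; ν₂) ≤ w_axis(θ; ν) ≤ w_axis(θ; ν₁)` (any topology: `dWeightAxis` is the weight of the Γ–X axis state at the Fermi energy). [folklore] -/
theorem dWeightAxis_fermiEnergyOf_band {Δ a b c ν ν₁ ν₂ Eh : ℝ} (hΔ : 0 < Δ) (ha : a ≠ 0) (hc : 0 ≤ c) (hb : 0 ≤ b) (hν₁0 : 0 < ν₁) (hν : ν ∈ Icc ν₁ ν₂)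
    (hν₂1 : ν₂ < 1) (hEh : fermiEnergyOf Δ a b c ν₂ ≤ Eh) (hm : c * Eh < a ^ 2) (hlev : c * (2 * Δ * Eh + Eh ^ 2) ≤ a ^ 2 * Δ) :
    dWeightAxis Δ a b c (fermiEnergyOf Δ a b c ν₂) ≤ dWeightAxis Δ a b c (fermiEnergyOf Δ a b c ν) ∧
      dWeightAxis Δ a b c (fermiEnergyOf Δ a b c ν) ≤ dWeightAxis Δ a b c (fermiEnergyOf Δ a b c ν₁) := by
  have hν0 : 0 < ν := lt_of_lt_of_le hν₁0 hν.1
  have hν1 : ν < 1 := lt_of_le_of_lt hν.2 hν₂1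
  have hν₁1 : ν₁ < 1 := lt_of_le_of_lt hν.1 hν1
  have hE₁ : 0 < fermiEnergyOf Δ a b c ν₁ := fermiEnergyOf_pos hΔ ha hc hb hν₁0 hν₁1
  have hE : 0 < fermiEnergyOf Δ a b c ν := fermiEnergyOf_pos hΔ ha hc hb hν0 hν1
  have h1 : fermiEnergyOf Δ a b c ν₁ ≤ fermiEnergyOf Δ a b c ν := fermiEnergyOf_mono_filling' hΔ ha hc hb hν₁0 hν.1 hν1
  have h2 : fermiEnergyOf Δ a b c ν ≤ fermiEnergyOf Δ a b c ν₂ := fermiEnergyOf_mono_filling' hΔ ha hc hb hν0 hν.2 hν₂1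
  have hEν : fermiEnergyOf Δ a b c ν ≤ Eh := h2.trans hEh
  have hm2 : c * fermiEnergyOf Δ a b c ν₂ < a ^ 2 := lt_of_le_of_lt (mul_le_mul_of_nonneg_left hEh hc) hm
  have hmν : c * fermiEnergyOf Δ a b c ν < a ^ 2 := lt_of_le_of_lt (mul_le_mul_of_nonneg_left hEν hc) hm
  refine ⟨dWeightAxis_anti_eps hΔ ha hc hE h2 hm2 ?_, dWeightAxis_anti_eps hΔ ha hc hE₁ h1 hmν ?_⟩
  · exact (mul_le_mul_of_nonneg_left (axisLever_le_of_ceiling hΔ.le hE.le h2 hEh) hc).trans hlev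
  · exact (mul_le_mul_of_nonneg_left (axisLever_le_of_ceiling hΔ.le hE₁.le h1 hEν) hc).trans hlev

/-- **Band read-out for `w_axis`**: `L ≤ w_axis(θ; ν₂)`, `w_axis(θ; ν₁) ≤ U` ⇒ `w_axis(θ; ν) ∈ [L, U]` at every `ν ∈ [ν₁, ν₂]`. [folklore] -/
theorem dWeightAxis_fermiEnergyOf_mem_Icc_of_band {Δ a b c ν ν₁ ν₂ Eh L U : ℝ} (hΔ : 0 < Δ) (ha : a ≠ 0) (hc : 0 ≤ c) (hb : 0 ≤ b) (hν₁0 : 0 < ν₁)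
    (hν : ν ∈ Icc ν₁ ν₂) (hν₂1 : ν₂ < 1) (hEh : fermiEnergyOf Δ a b c ν₂ ≤ Eh) (hm : c * Eh < a ^ 2) (hlev : c * (2 * Δ * Eh + Eh ^ 2) ≤ a ^ 2 * Δ)
    (hL : L ≤ dWeightAxis Δ a b c (fermiEnergyOf Δ a b c ν₂)) (hU : dWeightAxis Δ a b c (fermiEnergyOf Δ a b c ν₁) ≤ U) :
    dWeightAxis Δ a b c (fermiEnergyOf Δ a b c ν) ∈ Icc L U :=
  mem_Icc_of_band_ends (dWeightAxis_fermiEnergyOf_band hΔ ha hc hb hν₁0 hν hν₂1 hEh hm hlev) hL hU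

/-! ## §5 The Fermi-surface topology over a filling band -/

/-- **HOLE-LIKE OVER A FILLING BAND**: `X ≤ x_VH(θ)`, `1 − 2ν₁ < X` (the band's most-doped end is below the van Hove doping), `ε_F(θ; ν₂) ≤ E_h`, `t_pp′E_h < t_pd²`
⇒ at EVERY `ν ∈ [ν₁, ν₂]` the Fermi surface is hole-like: `0 < faceG(θ; ε_F(ν)) ∧ 1 < xAxis(θ; ε_F(ν))`. [folklore] -/
theorem holeLike_of_band {Δ a b c ν ν₁ ν₂ X Eh : ℝ} (hΔ : 0 < Δ) (ha : 0 < a) (hc : 0 ≤ c) (hb : 0 ≤ b) (hν₁0 : 0 < ν₁) (hν : ν ∈ Icc ν₁ ν₂)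
    (hν₂1 : ν₂ < 1) (hxX : X ≤ xVH Δ a b c) (hX : 1 - 2 * ν₁ < X) (hEh : fermiEnergyOf Δ a b c ν₂ ≤ Eh) (hm : c * Eh < a ^ 2) :
    0 < faceG Δ a c (fermiEnergyOf Δ a b c ν) ∧ 1 < xAxis Δ a c (fermiEnergyOf Δ a b c ν) := by
  have hν0 : 0 < ν := lt_of_lt_of_le hν₁0 hν.1
  have hν1 : ν < 1 := lt_of_le_of_lt hν.2 hν₂1
  have hx : 1 - 2 * ν < xVH Δ a b c := lt_of_le_of_lt (by linarith [hν.1]) (lt_of_lt_of_le hX hxX)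
  have hE0 := fermiEnergyOf_pos hΔ ha.ne' hc hb hν0 hν1
  have hmE : c * fermiEnergyOf Δ a b c ν < a ^ 2 :=
    lt_of_le_of_lt (mul_le_mul_of_nonneg_left (fermiEnergyOf_le_of_band hΔ ha.ne' hc hb hν0 hν.2 hν₂1 hEh) hc) hm
  exact holeLike_of_lt_xVH hΔ ha.ne' hc hb hν0 hν1 hx hmE

/-- **ELECTRON-LIKE OVER A FILLING BAND**: `x_VH(θ) ≤ X`, `X < 1 − 2ν₂` (the band's least-doped end is beyond the van Hove doping), `ε_F(θ; ν₂) ≤ E_h`,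
`t_pp′E_h < t_pd²` ⇒ at EVERY `ν ∈ [ν₁, ν₂]`: `faceG(θ; ε_F(ν)) < 0 ∧ xAxis(θ; ε_F(ν)) < 1`. [folklore] -/
theorem electronLike_of_band {Δ a b c ν ν₁ ν₂ X Eh : ℝ} (hΔ : 0 < Δ) (ha : 0 < a) (hc : 0 ≤ c) (hb : 0 ≤ b) (hν₁0 : 0 < ν₁) (hν : ν ∈ Icc ν₁ ν₂)
    (hν₂1 : ν₂ < 1) (hxX : xVH Δ a b c ≤ X) (hX : X < 1 - 2 * ν₂) (hEh : fermiEnergyOf Δ a b c ν₂ ≤ Eh) (hm : c * Eh < a ^ 2) :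
    faceG Δ a c (fermiEnergyOf Δ a b c ν) < 0 ∧ xAxis Δ a c (fermiEnergyOf Δ a b c ν) < 1 := by
  have hν0 : 0 < ν := lt_of_lt_of_le hν₁0 hν.1
  have hν1 : ν < 1 := lt_of_le_of_lt hν.2 hν₂1
  exact electronLike_of_xVH_le (c₂ := c) (a₁ := a) hΔ ha hc hb hν0 hν1 hxX (lt_of_lt_of_le hX (by linarith [hν.2]))
    (fermiEnergyOf_le_of_band hΔ ha.ne' hc hb hν0 hν.2 hν₂1 hEh) le_rfl le_rfl ha hm

/-! ## §6 The universal Fermi-surface weight ceiling over a box AND a filling band -/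

/-- **THE AXIS-CORNER CEILING OVER A BOX × FILLING BAND** (`EmeryOrbitalWeightAxisBox.dWeight_le_of_mem_box_axis'` with its two Fermi-energy brackets read at the END
fillings: `E_l ≤ ε_F(Δ₂, a₁, b₁, c₂; ν₁)`, `ε_F(Δ₁, a₂, b₂, c₁; ν₂) ≤ E_h`): EVERY Fermi-surface Bloch state of EVERY member at EVERY `ν ∈ [ν₁, ν₂]` has Cu-d weight `≤ hi`. [folklore] -/
theorem dWeight_le_of_mem_box_axis'_band {Δ a b c Δ₁ Δ₂ a₁ a₂ b₁ b₂ c₁ c₂ ν ν₁ ν₂ El Eh x y hi : ℝ} (hΔ₁ : 0 < Δ₁) (ha₁ : 0 < a₁) (hc₁ : 0 ≤ c₁)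
    (hcb : c₂ ≤ b₁) (hb₁ : 0 < b₁) (hΔ : Δ ∈ Icc Δ₁ Δ₂) (ha : a ∈ Icc a₁ a₂) (hb : b ∈ Icc b₁ b₂) (hc : c ∈ Icc c₁ c₂) (hν₁0 : 0 < ν₁)
    (hν : ν ∈ Icc ν₁ ν₂) (hν₂1 : ν₂ < 1) (hEl0 : 0 < El) (hEl : El ≤ fermiEnergyOf Δ₂ a₁ b₁ c₂ ν₁) (hEh : fermiEnergyOf Δ₁ a₂ b₂ c₁ ν₂ ≤ Eh)
    (hm : c₂ * Eh < a₁ ^ 2) (hlev : c₂ * (Δ₁ * (El + Eh) + El * Eh) ≤ a₁ ^ 2 * Δ₁) (hslope : c₂ * (El + Eh) ≤ a₁ ^ 2) (hhi : dWeightAxisCF Δ₂ a₁ c₂ El ≤ hi)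
    (hx : x ∈ Icc (0 : ℝ) 1) (hy : y ∈ Icc (0 : ℝ) 1) (hP : charCubic Δ a b c x y (fermiEnergyOf Δ a b c ν) = 0) :
    dWeight Δ a b c x y (fermiEnergyOf Δ a b c ν) ≤ hi := by
  have hν0 : 0 < ν := lt_of_lt_of_le hν₁0 hν.1
  have hν1 : ν < 1 := lt_of_le_of_lt hν.2 hν₂1
  have hΔ₂ : 0 < Δ₂ := lt_of_lt_of_le hΔ₁ (hΔ.1.trans hΔ.2)
  have ha₂ : 0 < a₂ := lt_of_lt_of_le ha₁ (ha.1.trans ha.2)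
  have hc₂ : 0 ≤ c₂ := hc₁.trans (hc.1.trans hc.2)
  have hb₂ : 0 ≤ b₂ := hb₁.le.trans (hb.1.trans hb.2)
  exact dWeight_le_of_mem_box_axis' hΔ₁ ha₁ hc₁ hcb hb₁ hΔ ha hb hc hν0 hν1 hEl0
    (le_fermiEnergyOf_of_band hΔ₂ ha₁.ne' hc₂ hb₁.le hν₁0 hν.1 hν1 hEl) (fermiEnergyOf_le_of_band hΔ₁ ha₂.ne' hc₁ hb₂ hν0 hν.2 hν₂1 hEh)
    hm hlev hslope hhi hx hy hP

end Summit.Ventures.CertifiedManyBodySolver.Downfold.Emery
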